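import Mathlib
import Literature.AlgebraicGeometry.Hironaka2017.WQUniversal

/-!
# Trace of the top vector of a Jordan block in characteristic `p` (solo-blind notes, §20.3 / §21)

For the linear Jordan block `σ x_{m} = x_{m} + x_{m-1}` of size `p` in characteristic `p`,
`σ^k (x_p) = ∑_j C(k,j) x_{p-j}`, so the trace `∑_{k<p} σ^k (x_p)` has coefficient
`∑_{k<p} C(k,j) = C(p, j+1)` in front of `x_{p-j}` (hockey stick).  Since `p ∣ C(p, j+1)` for
`1 ≤ j+1 ≤ p-1` and `C(p,p) = 1`, in a ring of characteristic `p` the trace of the top Jordan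
vector is the fixed vector: `Tr(x_p) = x_1`.  This is the binomial core of Proposition 20.3
(twisted fibre) and of Lemma 19.1(iv) (`u := Tr t̃` is a transversal parameter along a reduced
free fixed curve).  Using the hockey-stick identity (tree: `WQUniversal.sum_range_choose_eq`) we prove the divisibility, and the
ring-level statement `∑_{k<p} ∑_{j<p} C(k,j) • v j = v (p-1)` for an arbitrary family `v`
(read `v j = x_{p-j}`).
-/

namespace Summit.ResolutionOfSingularities.ResolutionOfSingularities.Theorems
namespace SoloBlind

open Finset

/- The hockey-stick identity `∑_{i<n} C(i,j) = C(n, j+1)` is already in the tree as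
`Literature.AlgebraicGeometry.Hironaka2017.WQUniversal.sum_range_choose_eq`; we use it. -/

/-- For a prime `p` and `j + 1 < p`: `p ∣ ∑_{i<p} C(i,j)`. -/
theorem jt_prime_dvd_sum_range_choose {p j : ℕ} (hp : p.Prime) (hj : j + 1 < p) :
    p ∣ ∑ i ∈ range p, i.choose j := by
  rw [Literature.AlgebraicGeometry.Hironaka2017.WQUniversal.sum_range_choose_eq]
  exact hp.dvd_choose_self (Nat.succ_ne_zero j) hj

/-- The top coefficient: `∑_{i<p} C(i, p-1) = 1` for `0 < p`. -/
theorem jt_sum_range_choose_top {p : ℕ} (hp : 0 < p) :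
    ∑ i ∈ range p, i.choose (p - 1) = 1 := by
  rw [Literature.AlgebraicGeometry.Hironaka2017.WQUniversal.sum_range_choose_eq]
  have : p - 1 + 1 = p := Nat.sub_add_cancel hp
  rw [this, Nat.choose_self]

variable {A : Type*} [CommRing A] (p : ℕ) [Fact p.Prime] [CharP A p]

/-- In characteristic `p`, the coefficient `∑_{i<p} C(i,j)` vanishes for `j + 1 < p`. -/
theorem jt_coeff_cast_eq_zero {j : ℕ} (hj : j + 1 < p) :
    ((∑ i ∈ range p, i.choose j : ℕ) : A) = 0 := by
  rw [CharP.cast_eq_zero_iff A p]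
  exact jt_prime_dvd_sum_range_choose (Fact.out) hj

omit [CharP A p] in
/-- In characteristic `p` (indeed in any ring), the top coefficient `∑_{i<p} C(i,p-1)` is `1`. -/
theorem jt_coeff_cast_top :
    ((∑ i ∈ range p, i.choose (p - 1) : ℕ) : A) = 1 := by
  rw [jt_sum_range_choose_top (Fact.out : p.Prime).pos, Nat.cast_one]

/-- Trace of the top Jordan vector equals the fixed vector: for any family `v : ℕ → A`
(think `v j = x_{p-j}`, so that `σ^k x_p = ∑_j C(k,j) v j`),
`∑_{k<p} ∑_{j<p} C(k,j) • v j = v (p-1)`. -/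
theorem jt_trace_top_eq_fixed (v : ℕ → A) :
    ∑ k ∈ range p, ∑ j ∈ range p, ((k.choose j : ℕ) : A) * v j = v (p - 1) := by
  have hp : p.Prime := Fact.out
  rw [sum_comm]
  have key : ∀ j ∈ range p,
      ∑ k ∈ range p, ((k.choose j : ℕ) : A) * v j = ((∑ k ∈ range p, k.choose j : ℕ) : A) * v j := by
    intro j _
    rw [← sum_mul, Nat.cast_sum]
  rw [sum_congr rfl key]
  rw [sum_eq_single (p - 1)]
  · rw [jt_coeff_cast_top p, one_mul]
  · intro j hj hne
    have hjp : j < p := mem_range.mp hj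
    have hj1 : j + 1 < p := by omega
    rw [jt_coeff_cast_eq_zero p hj1, zero_mul]
  · intro h
    exact absurd (mem_range.mpr (Nat.sub_lt hp.pos Nat.one_pos)) h

end SoloBlind
end Summit.ResolutionOfSingularities.ResolutionOfSingularities.Theorems
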